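import Summits.BirchSwinnertonDyer.BirchSwinnertonDyer.Theorems.KolyvaginRoadThreeMethod2StubAOfTame
import Summits.BirchSwinnertonDyer.BirchSwinnertonDyer.Theorems.KolyvaginRoadThreeMethod2StubAOfChebEquivIso
import Summits.BirchSwinnertonDyer.BirchSwinnertonDyer.Theorems.KolyvaginRoadThreeMethod2TameSign
import HarnessLib

/-!
# Method 2 at `p = 3` — stub A `stub_levelRaisingAtThree` of crux 19574, PROVED (by name)

Sub-problem `BirchSwinnertonDyer`, route `KolyvaginRoadThree`, METHOD line on the crux `ZhangSharpFrameAtThreeHL`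
(`stmt-BirchSwinnertonDyer-19574`), registered skeleton v2x (koly g12) / v2y (planner g28; stub A VERBATIM in both):
`Summits/BirchSwinnertonDyer/BirchSwinnertonDyer/Cruxes/ZhangSharpFrameAtThreeHL/Lines/method2.lean`.

`stub_levelRaisingAtThree` — **RANK LOWERING BY UNIPOTENT-ADMISSIBLE LEVEL RAISING AT `3`**, the registered stub-A text
VERBATIM and UNCONDITIONAL: at every Hoffstein–Luo A1 frame, for complex conjugation `c ≠ 1` and the `ZMod 3`-structure of
`H¹(K, E[3])`, every non-zero class of a good-level eigen-Selmer space `Sel_n^μ` is killed in `Sel_{n ∪ {q}}^μ` for some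
NEW good unipotent-admissible prime `q`, with `Sel_{n∪q}^μ ≤ Sel_n^μ` of codimension one and `Sel_{n∪q}^{−μ} = Sel_n^{−μ}`
(W. Zhang 2014 Prop. 5.4 + Lemma 7.3 + (9.1)–(9.2) at `p = 3`, koly MEMO-v8).

Assembly of the cell's kernel theorems, all `--supports stmt-BirchSwinnertonDyer-19574`:
* koly3a — the reduction `selQ_rankLowering_on_of_localGlobal` of (A1) to (Cheb), (Equiv), (Line), (Trans), (Iso)
  (`KolyvaginRoadThreeMethod2RankLoweringGood`), packaged by zhang3-p1 as `stub_levelRaisingAtThree_of_cheb_equiv_iso`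
  (`KolyvaginRoadThreeMethod2StubAOfChebEquivIso`, with (Line), (Trans) = `localLine_of_uAdmissible`,
  `localTrans_of_uAdmissible`);
* (Cheb) — `Cheb.hcheb` (koly g13, `KolyvaginRoadThreeMethod2Cheb` / `…StubAOfTame`: Čebotarev with the sign at `p = 3`);
* (Equiv) — `localEquiv_of_uAdmissible` (zhang3-p1, `KolyvaginRoadThreeMethod2TameSign`: the tame sign law, Serre 1972
  §1.8 Prop. 6, and Zhang (9.2));
* (Iso) — `Iso.hiso` (koly g13, `KolyvaginRoadThreeMethod2Iso`: Poitou–Tate see-saw, Zhang Prop. 5.4).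

No named fact, no `sorry`; axioms standard.  References: [cite: WZhang2014, Prop. 5.4, Lemma 7.3, §9 (9.1)–(9.3)]
[cite: BertoliniDarmon2005, Thm. 3.2] [cite: GrossLMS1991, §9 Prop. 9.3, 9.6] [cite: SerreInventiones1972, §1.8 Prop. 6].
-/

noncomputable section

open scoped Classical

namespace Summit.BirchSwinnertonDyer.Rank1Residual.X11b.Three.Koly.Method2StubA

open WeierstrassCurve NumberField IsDedekindDomain
  Literature.NumberTheory.EllipticCurves Literature.NumberTheory.EllipticCurves.ModularForms
  Literature.NumberTheory.GaloisRepresentations Module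
open Summit.BirchSwinnertonDyer.Rank1Residual.X11b.Three.Koly.Method2

/-- **stub A of crux 19574 — RANK LOWERING BY UNIPOTENT-ADMISSIBLE LEVEL RAISING AT 3 — PROVED** (the registered text
VERBATIM).  At every Hoffstein–Luo A1 frame, for complex conjugation `c ≠ 1` and the `ZMod 3`-structure of
`H¹(K, E[3])`: every non-zero class of `Sel_n^μ` (`n` a GOOD finite set of unipotent-admissible primes) is killed by
passing to `Sel_{n ∪ {q}}^μ` for some NEW good unipotent-admissible `q`, with `Sel_{n∪q}^μ ≤ Sel_n^μ` of codimension
exactly one and `Sel_{n∪q}^{−μ} = Sel_n^{−μ}`.  Proof: `stub_levelRaisingAtThree_of_cheb_equiv_iso` (koly3a's reduction,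
zhang3-p1's packaging) fed with `Cheb.hcheb` (Čebotarev with the sign), `localEquiv_of_uAdmissible` (tame sign law) and
`Iso.hiso` (Poitou–Tate see-saw). [cite: WZhang2014, Prop. 5.4, Lemma 7.3, §9 (9.1)–(9.2)]
[cite: BertoliniDarmon2005, Thm. 3.2] [cite: GrossLMS1991, Prop. 9.3, 9.6] -/
theorem stub_levelRaisingAtThree :
    ∀ (W : WeierstrassCurve ℚ) [W.IsElliptic] [W.IsGloballyMinimal] [NeZero (W.conductorNorm ℤ)] (K : Type)
      [Field K] [NumberField K] (Dt : ModularParametrizationData W (W.conductorNorm ℤ)) (β : ℤ) (ι : K →+* ℂ),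
      Summit.BirchSwinnertonDyer.Rank1Residual.ClassX11b W 3 → W.HasMultiplicativeReductionAtPrime 3 →
      Rank1Residual.Surj W 3 → Rank1Residual.Ram W 3 → ¬ 3 ∣ W.tamagawaProduct → IsImaginaryQuadratic K →
      Odd (NumberField.discr K) → SatisfiesHeegnerHypothesis (W.conductorNorm ℤ) K →
      (W.quadraticTwist (NumberField.discr K : ℚ)).entireLFunction 1 ≠ 0 → NumberField.discr K ≠ -3 →
      (4 * (W.conductorNorm ℤ : ℤ)) ∣ β ^ 2 - NumberField.discr K → ¬ (3 : ℤ) ∣ Dt.c →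
      ∀ (c : K ≃ₐ[ℚ] K), c ≠ 1 → ∀ [Module (ZMod 3) (V3 W K)],
      -- (A1) rank lowering at one new GOOD (non-scalar) unipotent-admissible prime, on good levels, (9.1)–(9.2)
      (∀ (n : Finset {q // IsUAdmissiblePrime W K q}) (μ : Bool) (x : V3 W K),
        GoodLevel W K n → x ∈ SelQ W K c n μ → x ≠ 0 →
        ∃ q : {q // IsUAdmissiblePrime W K q}, q ∉ n ∧ GoodLevel W K (insert q n) ∧
          x ∉ SelQ W K c (insert q n) μ ∧
          SelQ W K c (insert q n) μ ≤ SelQ W K c n μ ∧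
          finrank (ZMod 3) (SelQ W K c (insert q n) μ) + 1 = finrank (ZMod 3) (SelQ W K c n μ) ∧
          SelQ W K c (insert q n) (!μ) = SelQ W K c n (!μ)) :=
  stub_levelRaisingAtThree_of_cheb_equiv_iso fun W _ _ _ K _ _ _ _ _ _ hmult hsurj _ _ hK _ hH _ _ _ _ c hc1 _ ↦
    ⟨Cheb.hcheb W K hK hsurj hmult hH hc1, localEquiv_of_uAdmissible W K hK.1 hc1, Iso.hiso W K c hK⟩

end Summit.BirchSwinnertonDyer.Rank1Residual.X11b.Three.Koly.Method2StubA

end
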